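import Literature.NumberTheory.Rogawski1990.AdelicCartanClass
import HarnessLib

/-!
# Kottwitz's criterion (Prop. 3.3.1) for the obstruction of a regular stable class of `U(H)`, ASSEMBLED from its four steps: the CFT step
# «`obs = 0` iff the adelic Cartan class is globally represented», the discriminant and signature readings of a global representative, and the
# local∕archimedean projection of the class (Rogawski 1990, §3.3 Prop. 3.3.1 p. 22, §3.5 Prop. 3.5.2 p. 29, §5.4 p. 72; Kottwitz 1986 §9)

Topic `NumberTheory/Rogawski1990`; namespace `Literature.NumberTheory.Rogawski1990`; **THEOREMS ONLY** (no definition, no named fact, no instance, no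
notation, no `sorry`).  Cell `pub/hodgecm-mathlib`, ENGINE T1 (crux H413 = `stmt-HodgeConjecture-24833`), row G6, piece P5 of
`BLUEPRINT-R6dR7-CartanObsHasse.F0P5a-p03g4` (0a35b92f): the COMPOSITION of Prop. 3.3.1 on the self carrier ★ `MatchingAdeleG₂ L H H γ₀`, with the four
remaining pieces as HYPOTHESES in their final binder shapes — (P4) `hglob` «`obs p = 0 ↔` the adelic Cartan class `x_g` of `p` is `t⋆ (y ⊗ 1) t` for a GLOBAL
`⋆`-symmetric unit `y ∈ Z(γ₀)`» (`CartanObstruction`, over ★ R3′∕R6c), (P2) `hdisc` «then `det y ∈ N_{L∕L⁺}(Lˣ)`» (`AdelicCartanDisc`, CM Hasse norm), (P3) `hsig`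
«then `H·y` and `H` have the same signatures» (`AdelicCartanArch`, ★ (G-c)∕(G-c∞)), (P1) `hloc` «norm-equivalent adelic classes ⇒ conjugate in `U(H)(F_v)` for
every `v` and in `U(H)(L ⊗ ℝ)`» (`AdelicCartanClassLocal`) — so that `CartanObsHasse` is `cartanObsHasse_of_steps` applied to four theorems.  Everything
else is ★: R6b `exists_gl_conj_eq_adele` ∕ `isRationalOver_of_isConj_arch_of_forall_isConj_toLocal` (A-p10), R6a `exists_unitary_conj_inv_mul_twistGram_eq_of_invariants`
(realisation by Landherr), R6d-β `exists_exists_commute_adelicCartan_eq_map_of_isRationalOver` (rational ⇒ principal).  HC_CM is proved only modulo the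
printed citations until rung 0 closes.

THE PROOF OF PROP. 3.3.1 SO ASSEMBLED.  (←) `p` rational over `γ` ⇒ `γ = g₀ γ₀ g₀⁻¹` (descent at `∞`) and `x_g = t⋆ ((H⁻¹ H_{g₀}) ⊗ 1) t` (★ R6d-β), and
`y := H⁻¹ H_{g₀}` is a global `⋆`-symmetric unit of `Z(γ₀)` (★ R1∕R2∕R6a), so `obs p = 0` by (P4).  (→) `obs p = 0` ⇒ (P4) a global representative `(y, t)` ⇒
(P2)(P3) its invariants agree with those of `H` ⇒ ★ R6a (Landherr) a rational `δ = g₀ γ₀ g₀⁻¹ ∈ U(H)(L⁺)` with `H⁻¹ H_{g₀} = y` ⇒ the self adèle `δ ⊗ 1` has class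
`y ⊗ 1`, norm-equivalent to `x_g` ⇒ (P1) `p_v ∼ δ` in `U(H)(F_v)` for all `v` and `p_∞ ∼ δ ⊗ 1` ⇒ ★ R6b (gluing, Kottwitz 7.1) `p` is `U(H)(𝐀)`-conjugate to
`δ ⊗ 1`, i.e. rational over `δ`.

## References
* [Rogawski1990] J. D. Rogawski, *Automorphic Representations of Unitary Groups in Three Variables*, Ann. of Math. Stud. 123 (1990), §3.3 Prop. 3.3.1 p. 22,
  §3.5 Prop. 3.5.2 p. 29, §5.4 p. 72.
* [Kottwitz1986] R. E. Kottwitz, *Stable trace formula: elliptic singular terms*, Math. Ann. 275 (1986), §7 Prop. 7.1, §9.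
-/

set_option autoImplicit false

noncomputable section

open NumberField IsDedekindDomain
open scoped Matrix MatrixGroups

namespace Literature.NumberTheory.Rogawski1990

open Literature.NumberTheory.Automorphic
open Literature.AlgebraicGeometry.ShimuraVarieties (unitaryGroup mem_unitaryGroup_iff)

section Self

variable {L : Type} [Field L] [NumberField L] [IsCMField L] {H : Matrix (Fin 3) (Fin 3) L} {γ₀ : (UnitaryGroup.cmDatum L 3 H).Rational}

/-- `γ₀`-regularity passes to every `δ = g₀ γ₀ g₀⁻¹`. [cite: Rogawski1990, §3.1 p. 19] -/
theorem isRegularElt_of_conj_eq (hreg : IsRegularElt ((γ₀ : unitaryGroup (cmConjRingHom L) H).val : GL (Fin 3) L))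
    {δ : (UnitaryGroup.cmDatum L 3 H).Rational} {g₀ : GL (Fin 3) L}
    (hg₀ : g₀ * ((γ₀ : unitaryGroup (cmConjRingHom L) H).val : GL (Fin 3) L) * g₀⁻¹ = ((δ : unitaryGroup (cmConjRingHom L) H).val : GL (Fin 3) L)) :
    IsRegularElt ((δ : unitaryGroup (cmConjRingHom L) H).val : GL (Fin 3) L) :=
  isRegularElt_of_isConj (isConj_iff.mpr ⟨g₀, hg₀⟩) hreg

/-- The global Cartan class `y := H⁻¹ H_{g₀}` of a rational `δ = g₀ γ₀ g₀⁻¹` is a `⋆`-symmetric unit of `Z(γ₀)` (★ R1 `commute_inv_mul_twistGram`, ★ R2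
`hermStar_inv_mul_twistGram`, ★ R6a `det_inv_mul_twistGram`). [cite: Rogawski1990, §3.5 Prop. 3.5.2 p. 29] -/
theorem globalCartan_props (hH : (H.map (cmConjRingHom L))ᵀ = H) (hHd : H.det ≠ 0) {δ : (UnitaryGroup.cmDatum L 3 H).Rational} {g₀ : GL (Fin 3) L}
    (hg₀ : g₀ * ((γ₀ : unitaryGroup (cmConjRingHom L) H).val : GL (Fin 3) L) * g₀⁻¹ = ((δ : unitaryGroup (cmConjRingHom L) H).val : GL (Fin 3) L)) :
    Commute (H⁻¹ * twistGram (cmConjRingHom L) H (g₀ : Matrix (Fin 3) (Fin 3) L)) (((γ₀ : unitaryGroup (cmConjRingHom L) H).val : GL (Fin 3) L) : Matrix (Fin 3) (Fin 3) L) ∧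
      hermStar (cmConjRingHom L) H (H⁻¹ * twistGram (cmConjRingHom L) H (g₀ : Matrix (Fin 3) (Fin 3) L)) = H⁻¹ * twistGram (cmConjRingHom L) H (g₀ : Matrix (Fin 3) (Fin 3) L) ∧
      IsUnit (H⁻¹ * twistGram (cmConjRingHom L) H (g₀ : Matrix (Fin 3) (Fin 3) L)).det := by
  refine ⟨commute_inv_mul_twistGram (cmConjRingHom L) H (Ne.isUnit hHd) (γ := (γ₀ : unitaryGroup (cmConjRingHom L) H))
      (δ := (δ : unitaryGroup (cmConjRingHom L) H)) hg₀,
    hermStar_inv_mul_twistGram (cmConjRingHom L) H (Ne.isUnit hHd) (fun x => by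
      rw [cmConjRingHom_apply, cmConjRingHom_apply, IsCMField.complexConj_apply_apply]) hH _, ?_⟩
  rw [det_inv_mul_twistGram (cmConjRingHom L) H (Ne.isUnit hHd)]
  have hu : IsUnit (g₀ : Matrix (Fin 3) (Fin 3) L).det := (Matrix.isUnits_det_units g₀)
  exact (hu.map (cmConjRingHom L)).mul hu

/-- **KOTTWITZ'S CRITERION ASSEMBLED FROM ITS STEPS (Prop. 3.3.1 on the self carrier, `𝓡 = ⊤` so «`κ(obs) = 1 ∀ κ`» is «`obs = 0`»)**: for `H` hermitian
non-degenerate, `γ₀ ∈ U(H)(L⁺)` regular, and ANY obstruction `obs` on the matching adèles over `γ₀` satisfying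
(P4) `hglob` — `obs p = 0` iff the adelic Cartan class `x_g` of (any) adelic conjugator `g` of `p` is `t⋆ (y ⊗ 1) t` with `y` a GLOBAL `⋆`-symmetric unit
commuting with `γ₀` and `t ∈ GL₃(𝔸_L)` commuting with `γ₀ ⊗ 1`;
(P2) `hdisc` — such a `y` has `det y = z σ(z)`, `z ∈ Lˣ`; (P3) `hsig` — and `H·y`, `H` have equal signatures at every complex embedding;
(P1) `hloc` — norm-equivalent adelic classes (`x_g = t⋆ x_{g′} t`) of matching adèles `p, q` force `q_v ∼ p_v` in `U(H)(F_v)` for every finite `v` and `q_∞ ∼ p_∞`;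
then **`obs p = 0 ↔ ∃ γ, p.IsRationalOver γ`** for every `p` — the `hHasse` clause of ★ `PreStabilisationCountSigns` ∕ the floor-0 package.
[cite: Rogawski1990, §3.3 Prop. 3.3.1 p. 22; §3.5 Prop. 3.5.2 p. 29; §5.4 p. 72] [cite: Kottwitz1986, §7 Prop. 7.1, §9] -/
theorem cartanObsHasse_of_steps (hH : (H.map (cmConjRingHom L))ᵀ = H) (hHd : H.det ≠ 0)
    (hreg : IsRegularElt ((γ₀ : unitaryGroup (cmConjRingHom L) H).val : GL (Fin 3) L))
    {A : Type*} [AddCommGroup A] (obs : MatchingAdeleG₂ L H H γ₀ → A)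
    (hglob : ∀ (p : MatchingAdeleG₂ L H H γ₀) (g : GL (Fin 3) (AdeleRing (𝓞 L) L)),
      g * (((UnitaryGroup.cmDatum L 3 H).toAdelic γ₀).val : GL (Fin 3) (AdeleRing (𝓞 L) L)) * g⁻¹ = (p.adele.val : GL (Fin 3) (AdeleRing (𝓞 L) L)) →
      (obs p = 0 ↔ ∃ (y : Matrix (Fin 3) (Fin 3) L) (t : GL (Fin 3) (AdeleRing (𝓞 L) L)),
        Commute y (((γ₀ : unitaryGroup (cmConjRingHom L) H).val : GL (Fin 3) L) : Matrix (Fin 3) (Fin 3) L) ∧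
        hermStar (cmConjRingHom L) H y = y ∧ IsUnit y.det ∧
        t * (((UnitaryGroup.cmDatum L 3 H).toAdelic γ₀).val : GL (Fin 3) (AdeleRing (𝓞 L) L)) =
          (((UnitaryGroup.cmDatum L 3 H).toAdelic γ₀).val : GL (Fin 3) (AdeleRing (𝓞 L) L)) * t ∧
        (H.map (algebraMap L (AdeleRing (𝓞 L) L)))⁻¹ * twistGram (adeleConj L) (H.map (algebraMap L (AdeleRing (𝓞 L) L))) (g : Matrix (Fin 3) (Fin 3) (AdeleRing (𝓞 L) L)) =
          hermStar (adeleConj L) (H.map (algebraMap L (AdeleRing (𝓞 L) L))) (t : Matrix (Fin 3) (Fin 3) (AdeleRing (𝓞 L) L)) *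
            y.map (algebraMap L (AdeleRing (𝓞 L) L)) * (t : Matrix (Fin 3) (Fin 3) (AdeleRing (𝓞 L) L))))
    (hdisc : ∀ (p : MatchingAdeleG₂ L H H γ₀) (g : GL (Fin 3) (AdeleRing (𝓞 L) L)) (y : Matrix (Fin 3) (Fin 3) L) (t : GL (Fin 3) (AdeleRing (𝓞 L) L)),
      g * (((UnitaryGroup.cmDatum L 3 H).toAdelic γ₀).val : GL (Fin 3) (AdeleRing (𝓞 L) L)) * g⁻¹ = (p.adele.val : GL (Fin 3) (AdeleRing (𝓞 L) L)) →
      Commute y (((γ₀ : unitaryGroup (cmConjRingHom L) H).val : GL (Fin 3) L) : Matrix (Fin 3) (Fin 3) L) → hermStar (cmConjRingHom L) H y = y → IsUnit y.det →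
      (H.map (algebraMap L (AdeleRing (𝓞 L) L)))⁻¹ * twistGram (adeleConj L) (H.map (algebraMap L (AdeleRing (𝓞 L) L))) (g : Matrix (Fin 3) (Fin 3) (AdeleRing (𝓞 L) L)) =
        hermStar (adeleConj L) (H.map (algebraMap L (AdeleRing (𝓞 L) L))) (t : Matrix (Fin 3) (Fin 3) (AdeleRing (𝓞 L) L)) *
          y.map (algebraMap L (AdeleRing (𝓞 L) L)) * (t : Matrix (Fin 3) (Fin 3) (AdeleRing (𝓞 L) L)) →
      ∃ z : L, z ≠ 0 ∧ y.det = z * cmConjRingHom L z)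
    (hsig : ∀ (p : MatchingAdeleG₂ L H H γ₀) (g : GL (Fin 3) (AdeleRing (𝓞 L) L)) (y : Matrix (Fin 3) (Fin 3) L) (t : GL (Fin 3) (AdeleRing (𝓞 L) L)),
      g * (((UnitaryGroup.cmDatum L 3 H).toAdelic γ₀).val : GL (Fin 3) (AdeleRing (𝓞 L) L)) * g⁻¹ = (p.adele.val : GL (Fin 3) (AdeleRing (𝓞 L) L)) →
      Commute y (((γ₀ : unitaryGroup (cmConjRingHom L) H).val : GL (Fin 3) L) : Matrix (Fin 3) (Fin 3) L) → hermStar (cmConjRingHom L) H y = y → IsUnit y.det →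
      (H.map (algebraMap L (AdeleRing (𝓞 L) L)))⁻¹ * twistGram (adeleConj L) (H.map (algebraMap L (AdeleRing (𝓞 L) L))) (g : Matrix (Fin 3) (Fin 3) (AdeleRing (𝓞 L) L)) =
        hermStar (adeleConj L) (H.map (algebraMap L (AdeleRing (𝓞 L) L))) (t : Matrix (Fin 3) (Fin 3) (AdeleRing (𝓞 L) L)) *
          y.map (algebraMap L (AdeleRing (𝓞 L) L)) * (t : Matrix (Fin 3) (Fin 3) (AdeleRing (𝓞 L) L)) →
      ∀ (ρ : L →+* ℂ) (h₁ : (H.map ρ).IsHermitian) (h₂ : ((H * y).map ρ).IsHermitian),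
        (Finset.univ.filter fun i => 0 < h₁.eigenvalues i).card = (Finset.univ.filter fun i => 0 < h₂.eigenvalues i).card)
    (hloc : ∀ (p q : MatchingAdeleG₂ L H H γ₀) (g g' t : GL (Fin 3) (AdeleRing (𝓞 L) L)),
      g * (((UnitaryGroup.cmDatum L 3 H).toAdelic γ₀).val : GL (Fin 3) (AdeleRing (𝓞 L) L)) * g⁻¹ = (p.adele.val : GL (Fin 3) (AdeleRing (𝓞 L) L)) →
      g' * (((UnitaryGroup.cmDatum L 3 H).toAdelic γ₀).val : GL (Fin 3) (AdeleRing (𝓞 L) L)) * g'⁻¹ = (q.adele.val : GL (Fin 3) (AdeleRing (𝓞 L) L)) →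
      t * (((UnitaryGroup.cmDatum L 3 H).toAdelic γ₀).val : GL (Fin 3) (AdeleRing (𝓞 L) L)) =
        (((UnitaryGroup.cmDatum L 3 H).toAdelic γ₀).val : GL (Fin 3) (AdeleRing (𝓞 L) L)) * t →
      (H.map (algebraMap L (AdeleRing (𝓞 L) L)))⁻¹ * twistGram (adeleConj L) (H.map (algebraMap L (AdeleRing (𝓞 L) L))) (g : Matrix (Fin 3) (Fin 3) (AdeleRing (𝓞 L) L)) =
        hermStar (adeleConj L) (H.map (algebraMap L (AdeleRing (𝓞 L) L))) (t : Matrix (Fin 3) (Fin 3) (AdeleRing (𝓞 L) L)) *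
          ((H.map (algebraMap L (AdeleRing (𝓞 L) L)))⁻¹ * twistGram (adeleConj L) (H.map (algebraMap L (AdeleRing (𝓞 L) L))) (g' : Matrix (Fin 3) (Fin 3) (AdeleRing (𝓞 L) L))) *
          (t : Matrix (Fin 3) (Fin 3) (AdeleRing (𝓞 L) L)) →
      (∀ v : HeightOneSpectrum (𝓞 ↥(maximalRealSubfield L)),
          IsConj ((UnitaryGroup.cmDatum L 3 H).toLocal v q.adele) ((UnitaryGroup.cmDatum L 3 H).toLocal v p.adele)) ∧
        IsConj q.arch p.arch)
    (p : MatchingAdeleG₂ L H H γ₀) : obs p = 0 ↔ ∃ γ : (UnitaryGroup.cmDatum L 3 H).Rational, p.IsRationalOver γ := by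
  -- one adelic conjugator of `p` (★ R6b)
  obtain ⟨g, hg⟩ := p.exists_gl_conj_eq_adele hreg
  constructor
  · -- (→): global representative ⇒ Landherr realisation ⇒ local conjugacy ⇒ gluing
    intro h0
    obtain ⟨y, t, hyγ, hys, hyu, ht, hx⟩ := (hglob p g hg).mp h0
    obtain ⟨z, hz, hdet⟩ := hdisc p g y t hg hyγ hys hyu hx
    have hsg := hsig p g y t hg hyγ hys hyu hx
    obtain ⟨g₀, δ, hg₀, hst, hcl⟩ := exists_unitary_conj_inv_mul_twistGram_eq_of_invariants L hH hHd (γ₀ : unitaryGroup (cmConjRingHom L) H) hyγ hys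
      hyu.ne_zero hsg ⟨z, hz, hdet⟩
    -- the self adèle `q = δ ⊗ 1`, conjugator `g₀ ⊗ 1`, class `y ⊗ 1`
    set q : MatchingAdeleG₂ L H H γ₀ := MatchingAdeleG₂.ofIsStablyConjSelf hst with hqdef
    have hq : q.adele = (UnitaryGroup.cmDatum L 3 H).toAdelic δ := MatchingAdeleG₂.adele_ofIsStablyConjSelf hst
    have hg' : toAdeleGL L g₀ * (((UnitaryGroup.cmDatum L 3 H).toAdelic γ₀).val : GL (Fin 3) (AdeleRing (𝓞 L) L)) * (toAdeleGL L g₀)⁻¹ =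
        (q.adele.val : GL (Fin 3) (AdeleRing (𝓞 L) L)) := by
      rw [hq, UnitaryGroup.coe_cmDatum_toAdelic, UnitaryGroup.coe_cmDatum_toAdelic, ← map_inv, ← map_mul, ← map_mul, hg₀]
    have hx' : (H.map (algebraMap L (AdeleRing (𝓞 L) L)))⁻¹ * twistGram (adeleConj L) (H.map (algebraMap L (AdeleRing (𝓞 L) L)))
          ((toAdeleGL L g₀ : GL (Fin 3) (AdeleRing (𝓞 L) L)) : Matrix (Fin 3) (Fin 3) (AdeleRing (𝓞 L) L)) = y.map (algebraMap L (AdeleRing (𝓞 L) L)) := by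
      rw [val_toAdeleGL, ← twistGram_map_adele, ← Literature.LinearAlgebra.Matrix.map_nonsing_inv_of_isUnit _ (Ne.isUnit hHd), ← Matrix.map_mul, hcl]
    have hrel : (H.map (algebraMap L (AdeleRing (𝓞 L) L)))⁻¹ * twistGram (adeleConj L) (H.map (algebraMap L (AdeleRing (𝓞 L) L))) (g : Matrix (Fin 3) (Fin 3) (AdeleRing (𝓞 L) L)) =
        hermStar (adeleConj L) (H.map (algebraMap L (AdeleRing (𝓞 L) L))) (t : Matrix (Fin 3) (Fin 3) (AdeleRing (𝓞 L) L)) *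
          ((H.map (algebraMap L (AdeleRing (𝓞 L) L)))⁻¹ * twistGram (adeleConj L) (H.map (algebraMap L (AdeleRing (𝓞 L) L)))
            ((toAdeleGL L g₀ : GL (Fin 3) (AdeleRing (𝓞 L) L)) : Matrix (Fin 3) (Fin 3) (AdeleRing (𝓞 L) L))) *
          (t : Matrix (Fin 3) (Fin 3) (AdeleRing (𝓞 L) L)) := by rw [hx', hx]
    obtain ⟨hv, ha⟩ := hloc p q g (toAdeleGL L g₀) t hg hg' ht hrel
    -- regularity of `δ`, and the gluing (★ R6b converse)
    have hregδ : IsRegularElt ((δ : unitaryGroup (cmConjRingHom L) H).val : GL (Fin 3) L) := isRegularElt_of_conj_eq hreg hg₀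
    refine ⟨δ, p.isRationalOver_of_isConj_arch_of_forall_isConj_toLocal hH hHd hregδ ?_ fun v => ?_⟩
    · have ha' : q.arch = cmRationalToArch L 3 H δ := by
        show UnitaryGroup.archPart (↥(maximalRealSubfield L)) L (IsCMField.complexConj L) 3 H q.adele = _
        rw [hq, archPart_cmDatum_toAdelic]
      rw [← ha']
      exact ha
    · have := hv v
      rwa [hq] at this
  · -- (←): rational ⇒ principal (★ R6d-β) ⇒ global representative ⇒ `obs = 0` by (P4)
    rintro ⟨γ, hp⟩
    obtain ⟨g₀, hg₀, t, ht, hx⟩ := exists_exists_commute_adelicCartan_eq_map_of_isRationalOver (Ne.isUnit hHd) hp hg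
    obtain ⟨hyγ, hys, hyu⟩ := globalCartan_props hH hHd hg₀
    exact (hglob p g hg).mpr ⟨_, t, hyγ, hys, hyu, ht, hx⟩

end Self

end Literature.NumberTheory.Rogawski1990

end
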